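import Mathlib
import Literature.MathematicalPhysics.QuantumFieldTheory.Balaban1983to89.B12BetaHolo
import Literature.MathematicalPhysics.QuantumFieldTheory.Balaban1983to89.B12Decay510
import Literature.Analysis.Complex.VitaliConvergence

/-!
# `Balaban1983to89.B12PolarizationHolo` — [Balaban1987RG1] (1.20)–(1.21) p. 264 IN HOLOMORPHIC CURRENCY: from the terms
# `𝐄^{(j)}(X, g, ·)` analytic in the coupling (p. 266) through (4.35)∕(4.37) p. 290 and the limit (1.21) to a vacuum-polarization
# kernel HOLOMORPHIC in the coupling with (5.10) on a complex neighbourhood of [0, γ] — the untyped layer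
# `B12BetaSmooth.PolarizationDerivTransfer`, typed and PROVED in the «(or analytic)» alternative

T. Bałaban, *Renormalization group approach to lattice gauge field theories. I*, Commun. Math. Phys. **109** (1987) 249–301
[Balaban1987RG1] (cell paper B12 = «[I]»; PDF page = journal page − 248).  TRACK A (YM-PLAN §2b), DAG node N09 = `Dag.B12_main`,
seat `pub-ymgap-dag-n09-a` (KNIT-BY-NAME, g2).  Companion of `…B12BetaHolo` (the β-clauses from a holomorphic Π-source
`PiHoloSource`); satellite of `…B12Decay510` (the polymer-sum derivation of (5.10)) and of `Literature.Analysis.Complex.VitaliConvergence`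
(Vitali's convergence theorem, in the tree); nothing landed is modified.

## WHAT PRINT SAYS (verbatim)

* p. 266 [PDF 18]: *«… It has the advantage that the functions E^{(j)}, β_j are analytic functions of the effective coupling
  constants … We have formulated the implications of both possibilities in the inductive description.»*
* p. 264 [PDF 16], (1.20): `Π^{ab}_{j+1,μν}(g_j, x, x′) = (δ²/δB^a_μ(x) δB^b_ν(x′) 𝐄^{(j+1)})(g_j, 0)`; (1.21): *«Now we take a limit of
  these functions as T^{(j+1)} ↗ Z^d. This limit exists by the localized representation (1.7).»*
* p. 290 [PDF 42], (4.35): *«𝐄^{(2)}(X) = ⟨(δ²/δ𝐇²)𝐄(X, 1), H_j(□₀), H_j(□₀)⟩»*; p. 291 (4.37): *«Π_{μ,ν}(x, y) = Σ_{X∈𝐃⁰_j} 𝐄^{(2)}_{μ,ν}(X,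
  x, y) …»*; p. 281 [33], (4.3)–(4.4): the mixed τ-derivative form and the analyticity domain *«max{∣𝐀∣_X, …} < α₂»*; p. 263 (1.18):
  *«∣𝐄^{(j)}(X, g_{j−1}, 𝐔, 𝐉)∣ ≤ E₀ exp(−κd_j(X))»*; p. 293 [45], (5.10): *«The representation (4.37) yields the following inequality
  ∣Π_{μν}(x − y)∣ ≤ O(1)E₀ exp(−δ₁∣x − y∣)»*.

## WHAT THIS MODULE PROVES (0 sorry; axioms {propext, Classical.choice, Quot.sound})

* §1 (the one new analytic lemma).  For a family `F : ℂ → W → ℂ` of functions of the configuration `𝐀 ∈ W` JOINTLY ANALYTIC in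
  `(g, 𝐀)` on `U × {‖𝐀‖ < α}` (`U ⊆ ℂ` open): the (4.3) mixed derivative `∂²/∂τ₁∂τ₂ F(g, τ₁a + τ₂b)∣₀` (`B12Decay510.mixedDeriv (F g) a
  b`) is the second total Fréchet derivative at `(g, 0)` on the pair `((0, a), (0, b))` (`mixedDeriv_eq_fderiv2`) and is therefore
  HOLOMORPHIC IN `g` on `U` (`differentiableOn_mixedDeriv`; Mathlib `AnalyticOnNhd.fderiv` twice + chain rules).
* §2 (one finite volume, (4.37) at complex couplings).  The complex kernel `Π_T(g; x, y) := Σ_X ∂²/∂τ₁∂τ₂ 𝐄(X, g, τ₁h_X(x) +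
  τ₂h_X(y))∣₀` (`piT`) is holomorphic in `g` on `U` (`differentiableOn_piT`) and, at every `g` where the sections obey (1.18) on
  (4.4), satisfies (5.10) with the constants of `B12Decay510.abs_twoPoint_le_of_analytic` (`norm_piT_le`: Cauchy bilinear estimate
  `B12Decay510.norm_mixedDeriv_le` + minimizer decay + the polymer sum `abs_twoPoint_le_of_repr435` applied to the NORM kernel).
* §3 (the limit (1.21) by VITALI).  A sequence of functions holomorphic on a connected open `U ⊇ [0, γ]` (`γ > 0`), eventually
  bounded by `K` on `U`, and convergent at the REAL couplings `t ∈ [0, γ]` (print: «This limit exists»), converges on all of `U`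
  to a HOLOMORPHIC limit bounded by `K` and extending the real limits (`exists_holo_limit`;
  `Literature.Analysis.Complex.exists_tendstoLocallyUniformlyOn_of_frequently_tendsto`, the points `γ∕(j+2) → 0` accumulating in `U`).
* §4 (assembly).  For a sequence of finite systems (tori `T^{(k+1)} ↗ ℤ^d`) with the terms jointly analytic in `(g, 𝐀)` on
  `U ×` (4.4) and obeying (1.18) there UNIFORMLY IN `g ∈ U`, minimizer decay, the geometry ∕ cube-sum ∕ domain-sum leaves of
  `B12Decay510` with volume-uniform constants, window embeddings of `ℤ^d`, and convergence of the complex kernels at real couplings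
  to the printed limit `Pℓ t z`: there is a kernel `Pc(g, z)` HOLOMORPHIC in `g ∈ U`, obeying (5.10) ON `U` with
  `C = 4E₀α₂⁻²B₃² e^{δ₁Mc₁}K₀K₁`, `δ₁ = ½ min{δ₀, κM⁻¹}`, and equal to `Pℓ` at real couplings (`exists_holo_kernel`); hence — for a
  tower whose `β_{k+1}` is (5.42) of a real kernel whose `(μ, ν)`-component is `Re Pℓ` — `Nonempty (B12BetaHolo.PiHoloSource T c k)`
  (`nonempty_piHoloSource_of_analytic_leaves`), and with it EVERY β-clause of the step (`B12BetaHolo.betaClauses_of_piHolo`).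

RESIDUAL INPUTS (named hypotheses, located): joint analyticity of `(g, 𝐀) ↦ 𝐄^{(k+1)}(X, g, exp iξ𝐀)` on `U ×` (4.4) with (1.18) there
(p. 266 alternative + (1.5)∕(1.18) — the inductive hypotheses in their analytic-in-g form, N10's ∕ [II]'s to deliver for the new
term; unprinted as such), the minimizer decay p. 282 ([15] Sect. G), the elementary geometry leaves, the volume leaf behind
`TreeLeaf`, and the existence of the real-coupling limit (1.21) (print, by reference to (1.7)).  NOTHING about g-derivatives of
`E^{(j)}` is assumed (contrast `B12BetaSmooth.EDerivBound118`): Cauchy's estimates in `g` replace them.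

HONEST FRAMING.  Count-neutral Literature theorems; the Stage-5∕8 objects of record will instantiate the leaves.  Derives the p. 264
β-clause's Π-input in the analytic READING only; the SIGN of β (NODE O) is untouched.  One finite four-torus programme at fixed ε;
NOT ℝ⁴, NOT infinite volume, NOT OS axioms, NOT a mass gap, NOT the Clay problem.
-/

noncomputable section

open Set Filter Metric Topology Complex

namespace Literature.MathematicalPhysics.QuantumFieldTheory.Balaban1983to89.B12PolarizationHolo

open Literature.MathematicalPhysics.QuantumFieldTheory.Balaban1983to89
open Literature.MathematicalPhysics.QuantumFieldTheory.Balaban1983to89.Step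
open Literature.MathematicalPhysics.QuantumFieldTheory.Balaban1983to89.B12StepObligation
open Literature.MathematicalPhysics.QuantumFieldTheory.Balaban1983to89.B12BetaSmooth
open Literature.MathematicalPhysics.QuantumFieldTheory.Balaban1983to89.B12BetaHolo

/-! ## §1. Holomorphy in the coupling of the (4.3) mixed derivative, from joint analyticity in `(g, 𝐀)` -/

section Param

variable {W : Type*} [NormedAddCommGroup W] [NormedSpace ℂ W] {U : Set ℂ} {α : ℝ}

/-- The `𝐀`-section at a coupling `g ∈ U` of a jointly analytic family is analytic on the (4.4)-ball. [cite: Balaban1987RG1, (4.4) p.281 with p.266] -/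
theorem analyticOnNhd_section (F : ℂ → W → ℂ)
    (hF : AnalyticOnNhd ℂ (fun p : ℂ × W => F p.1 p.2) (U ×ˢ ball 0 α)) {g : ℂ} (hg : g ∈ U) :
    AnalyticOnNhd ℂ (F g) (ball 0 α) := fun v hv =>
  (hF (g, v) ⟨hg, hv⟩).comp₂ analyticAt_const analyticAt_id

/-- Partial = total derivative on vertical vectors: `D_𝐀 F(g, ·)(v) a = DF(g, v)(0, a)` inside `U ×` (4.4). [folklore] -/
private theorem fderiv_section_apply (F : ℂ → W → ℂ)
    (hF : AnalyticOnNhd ℂ (fun p : ℂ × W => F p.1 p.2) (U ×ˢ ball 0 α)) {g : ℂ} (hg : g ∈ U) {v : W}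
    (hv : v ∈ ball (0 : W) α) (a : W) :
    fderiv ℂ (F g) v a = fderiv ℂ (fun p : ℂ × W => F p.1 p.2) (g, v) (0, a) := by
  have hΦ : HasFDerivAt (fun p : ℂ × W => F p.1 p.2) (fderiv ℂ (fun p : ℂ × W => F p.1 p.2) (g, v)) (g, v) :=
    (hF (g, v) ⟨hg, hv⟩).differentiableAt.hasFDerivAt
  have hι : HasFDerivAt (fun w : W => ((g : ℂ), w))
      ((0 : W →L[ℂ] ℂ).prod (ContinuousLinearMap.id ℂ W)) v :=
    (hasFDerivAt_const g v).prodMk (hasFDerivAt_id v)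
  have hcomp := hΦ.comp v hι
  have hfun : ((fun p : ℂ × W => F p.1 p.2) ∘ fun w : W => ((g : ℂ), w)) = F g := rfl
  rw [hfun] at hcomp
  rw [hcomp.fderiv]
  simp

/-- **(4.3) as a second TOTAL derivative**: for `g ∈ U`, `∂²/∂τ₁∂τ₂ F(g, τ₁a + τ₂b)∣₀ = D²F(g, 0)[(0, a)][(0, b)]` (the outer
Fréchet derivative taken in `ℂ × W`).  Chain rule along `τ ↦ (g, τb)`. [cite: Balaban1987RG1, (4.3) p.281] -/
theorem mixedDeriv_eq_fderiv2 (hU : IsOpen U) (hα : 0 < α) (F : ℂ → W → ℂ)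
    (hF : AnalyticOnNhd ℂ (fun p : ℂ × W => F p.1 p.2) (U ×ˢ ball 0 α)) {g : ℂ} (hg : g ∈ U) (a b : W) :
    B12Decay510.mixedDeriv (F g) a b =
      fderiv ℂ (fun p : ℂ × W => fderiv ℂ (fun q : ℂ × W => F q.1 q.2) p (0, a)) (g, 0) (0, b) := by
  set Φ : ℂ × W → ℂ := fun q => F q.1 q.2 with hΦdef
  set Φ₁a : ℂ × W → ℂ := fun p => fderiv ℂ Φ p (0, a) with hΦ₁adef
  have hO : IsOpen (U ×ˢ ball (0 : W) α) := hU.prod isOpen_ball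
  have hΦ₁a : AnalyticOnNhd ℂ Φ₁a (U ×ˢ ball 0 α) := by
    have h1 := (ContinuousLinearMap.apply ℂ ℂ ((0 : ℂ), a)).comp_analyticOnNhd hF.fderiv
    simpa [Function.comp_def] using h1
  unfold B12Decay510.mixedDeriv
  have hev : ∀ᶠ τ : ℂ in 𝓝 0, τ • b ∈ ball (0 : W) α := by
    have hc : Continuous fun τ : ℂ => τ • b := continuous_id.smul continuous_const
    refine hc.continuousAt.preimage_mem_nhds (isOpen_ball.mem_nhds ?_)
    simpa using hα
  have hEq : (fun τ : ℂ => fderiv ℂ (F g) (τ • b) a) =ᶠ[𝓝 0] fun τ => Φ₁a (g, τ • b) :=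
    hev.mono fun τ hτ => fderiv_section_apply F hF hg hτ a
  rw [hEq.deriv_eq]
  have hγ : HasDerivAt (fun τ : ℂ => ((g : ℂ), τ • b)) ((0 : ℂ), b) 0 := by
    have h1 : HasDerivAt (fun τ : ℂ => τ • b) b 0 := by
      simpa using (hasDerivAt_id (0 : ℂ)).smul_const b
    exact (hasDerivAt_const (0 : ℂ) g).prodMk h1
  have hmem : ((g : ℂ), (0 : W)) ∈ U ×ˢ ball (0 : W) α := ⟨hg, mem_ball_self hα⟩
  have hΦ₂ : HasFDerivAt Φ₁a (fderiv ℂ Φ₁a (g, 0)) (g, 0) :=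
    (hΦ₁a _ hmem).differentiableAt.hasFDerivAt
  have h := HasFDerivAt.comp_hasDerivAt_of_eq (hl := hΦ₂) (hf := hγ) (hy := by simp)
  exact h.deriv

/-- **HOLOMORPHY IN THE COUPLING of the (4.3)∕(4.35) form**: if `(g, 𝐀) ↦ F(g, 𝐀)` is jointly analytic on `U × {‖𝐀‖ < α}`
(p. 266: *«the functions E^{(j)} … are analytic functions of the effective coupling constants»*, together with (4.4)), then for all
directions `a, b` the map `g ↦ ∂²/∂τ₁∂τ₂ F(g, τ₁a + τ₂b)∣₀` is holomorphic on `U`. [cite: Balaban1987RG1, p.266 (analytic alternative) with (4.3)–(4.4) p.281] -/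
theorem differentiableOn_mixedDeriv (hU : IsOpen U) (hα : 0 < α) (F : ℂ → W → ℂ)
    (hF : AnalyticOnNhd ℂ (fun p : ℂ × W => F p.1 p.2) (U ×ˢ ball 0 α)) (a b : W) :
    DifferentiableOn ℂ (fun g => B12Decay510.mixedDeriv (F g) a b) U := by
  set Φ : ℂ × W → ℂ := fun q => F q.1 q.2 with hΦdef
  set Φ₁a : ℂ × W → ℂ := fun p => fderiv ℂ Φ p (0, a) with hΦ₁adef
  have hΦ₁a : AnalyticOnNhd ℂ Φ₁a (U ×ˢ ball 0 α) := by
    have h1 := (ContinuousLinearMap.apply ℂ ℂ ((0 : ℂ), a)).comp_analyticOnNhd hF.fderiv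
    simpa [Function.comp_def] using h1
  have hΦ₂b : AnalyticOnNhd ℂ (fun p : ℂ × W => fderiv ℂ Φ₁a p (0, b)) (U ×ˢ ball 0 α) := by
    have h1 := (ContinuousLinearMap.apply ℂ ℂ ((0 : ℂ), b)).comp_analyticOnNhd hΦ₁a.fderiv
    simpa [Function.comp_def] using h1
  have hD : DifferentiableOn ℂ (fun g : ℂ => fderiv ℂ Φ₁a (g, 0) (0, b)) U := by
    intro g hg
    have h1 : DifferentiableAt ℂ (fun p : ℂ × W => fderiv ℂ Φ₁a p (0, b)) (g, 0) :=
      (hΦ₂b (g, 0) ⟨hg, mem_ball_self hα⟩).differentiableAt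
    have h2 : DifferentiableAt ℂ (fun g' : ℂ => ((g' : ℂ), (0 : W))) g :=
      differentiableAt_id.prodMk (differentiableAt_const _)
    exact (h1.comp g h2).differentiableWithinAt
  refine hD.congr fun g hg => ?_
  exact mixedDeriv_eq_fderiv2 hU hα F hF hg a b

end Param

/-! ## §2. One finite volume: the complex kernel (4.37) at complex couplings — holomorphy and (5.10) -/

section FiniteVolume

variable {S : LocDomainSys} {C : B12.CubeCover S} {Λ : Type*} {W : Type*} [NormedAddCommGroup W] [NormedSpace ℂ W]
  {U : Set ℂ}

/-- **(4.37)∕(1.20) at a complex coupling**: the finite-volume vacuum-polarization kernel `Π_T(g; x, y) = Σ_{X} 𝐄^{(2)}(X, g; x, y)` with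
`𝐄^{(2)}(X, g; x, y) = ∂²/∂τ₁∂τ₂ 𝐄(X, g, τ₁h_X(x) + τ₂h_X(y))∣₀` ((4.35) read componentwise through the restricted linearized-minimizer
responses `h_X`, as in `B12Decay510.abs_twoPoint_le_of_analytic`, but WITHOUT taking real parts — complex for complex `g`).
[cite: Balaban1987RG1, (4.37) p.291 with (4.35) p.290 and (1.20) p.264] -/
def piT (EX : ℂ → S.Dom → W → ℂ) (h : S.Dom → Λ → W) (g : ℂ) (x y : Λ) : ℂ :=
  ∑ X, B12Decay510.mixedDeriv (EX g X) (h X x) (h X y)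

/-- At a real coupling the tree's real kernel (real parts termwise, `B12Decay510.decay510_of_analytic_leaves`' `hrepr`) is the real
part of `Π_T`. [cite: Balaban1987RG1, (4.37) p.291] -/
theorem re_piT (EX : ℂ → S.Dom → W → ℂ) (h : S.Dom → Λ → W) (g : ℂ) (x y : Λ) :
    (piT EX h g x y).re = ∑ X, (B12Decay510.mixedDeriv (EX g X) (h X x) (h X y)).re := by
  simp [piT, Complex.re_sum]

/-- **`Π_T(·; x, y)` is holomorphic on `U`** when every term `(g, 𝐀) ↦ 𝐄(X, g, 𝐀)` is jointly analytic on `U ×` (4.4) (finite sum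
of §1). [cite: Balaban1987RG1, p.266 (analytic alternative) with (4.37) p.291] -/
theorem differentiableOn_piT (hU : IsOpen U) {α₂ : ℝ} (hα₂ : 0 < α₂) (EX : ℂ → S.Dom → W → ℂ)
    (h : S.Dom → Λ → W) (han : ∀ X, AnalyticOnNhd ℂ (fun p : ℂ × W => EX p.1 X p.2) (U ×ˢ ball 0 α₂))
    (x y : Λ) : DifferentiableOn ℂ (fun g => piT EX h g x y) U :=
  DifferentiableOn.fun_sum fun X _ => differentiableOn_mixedDeriv hU hα₂ (fun g => EX g X) (han X) _ _

/-- **(5.10) for `Π_T` at one (complex) coupling**, with the constants of `B12Decay510`: if the sections `𝐀 ↦ 𝐄(X, g, 𝐀)` are analytic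
on (4.4) with (1.18) there, the responses decay (p. 282), and the geometry ∕ cube-sum ∕ domain-sum leaves hold, then
`‖Π_T(g; x, y)‖ ≤ 4E₀α₂⁻² B₃² e^{δ₁Mc₁} K₀K₁ e^{−δ₁ρ(x,y)}`, `δ₁ = ½ min{δ₀, κM⁻¹}` — the polymer sum applied to the NORM kernel
`‖𝐄^{(2)}(X, g; x, y)‖`. [cite: Balaban1987RG1, (5.10) p.293] -/
theorem norm_piT_le (G : B12Decay510.SiteGeometry C Λ) {ρ : Λ → Λ → ℝ} (EX : ℂ → S.Dom → W → ℂ)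
    (h : S.Dom → Λ → W) {α₂ E₀ B₃ κ δ₀ M c₁ K₀ K₁ : ℝ} (hα₂ : 0 < α₂) (hE₀ : 0 ≤ E₀) (hB₃ : 0 ≤ B₃)
    (hK₀ : 0 ≤ K₀) (hδ₀ : 0 ≤ δ₀) (hκ : 0 ≤ κ) (hM : 0 < M) {g : ℂ}
    (han : ∀ X, AnalyticOnNhd ℂ (EX g X) (ball 0 α₂))
    (h118 : ∀ X, ∀ v ∈ ball (0 : W) α₂, ‖EX g X v‖ ≤ E₀ * Real.exp (-κ * S.dj X))
    (hh : ∀ X x, ‖h X x‖ ≤ B₃ * Real.exp (-δ₀ * G.distD x X))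
    (hgeo : B12Decay510.GeomLeaf G ρ M c₁) (hcube : B12Decay510.CubeSumLeaf G (δ₀ / 2) K₁)
    (htree : B12Decay510.TreeLeaf C (κ / 2) K₀) (x y : Λ) :
    ‖piT EX h g x y‖ ≤ 4 * E₀ / α₂ ^ 2 * B₃ ^ 2 * Real.exp (B12Decay510.delta1 δ₀ κ M * M * c₁) * K₀ * K₁ *
      Real.exp (-(B12Decay510.delta1 δ₀ κ M) * ρ x y) := by
  have hQ : ∀ X (a b : W), |‖B12Decay510.mixedDeriv (EX g X) a b‖| ≤
      4 * E₀ / α₂ ^ 2 * Real.exp (-κ * S.dj X) * ‖a‖ * ‖b‖ := fun X a b => by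
    rw [abs_norm]
    calc ‖B12Decay510.mixedDeriv (EX g X) a b‖
        ≤ 4 * (E₀ * Real.exp (-κ * S.dj X)) / α₂ ^ 2 * ‖a‖ * ‖b‖ :=
          B12Decay510.norm_mixedDeriv_le hα₂ (han X) (h118 X) a b
      _ = 4 * E₀ / α₂ ^ 2 * Real.exp (-κ * S.dj X) * ‖a‖ * ‖b‖ := by ring
  have hb := B12Decay510.abs_twoPoint_le_of_repr435 G (ρ := ρ) (V := fun _ => W)
    (fun X a b => ‖B12Decay510.mixedDeriv (EX g X) a b‖) h
    (fun X x' y' => ‖B12Decay510.mixedDeriv (EX g X) (h X x') (h X y')‖) (A := 4 * E₀ / α₂ ^ 2) (by positivity)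
    hB₃ hK₀ hδ₀ hκ hM (fun _ _ _ => rfl) hQ hh hgeo hcube htree x y
  calc ‖piT EX h g x y‖ ≤ ∑ X, ‖B12Decay510.mixedDeriv (EX g X) (h X x) (h X y)‖ := norm_sum_le _ _
    _ ≤ |∑ X, ‖B12Decay510.mixedDeriv (EX g X) (h X x) (h X y)‖| := le_abs_self _
    _ ≤ _ := hb

end FiniteVolume

/-! ## §3. The limit (1.21) in the coupling plane by Vitali's theorem, from convergence at REAL couplings -/

section Limit

variable {U : Set ℂ}

/-- The real couplings `γ∕(j+2)`, `j = 0, 1, …`, lie in `]0, γ]` and accumulate at `0`: a property holding at every point of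
`[0, γ]` (read in `ℂ`) holds frequently in the punctured neighbourhood of `0`. [folklore] -/
private theorem frequently_of_forall_Icc {γ : ℝ} (hγ : 0 < γ) {p : ℂ → Prop}
    (hp : ∀ t ∈ Icc (0 : ℝ) γ, p t) : ∃ᶠ w in 𝓝[≠] (0 : ℂ), p w := by
  set u : ℕ → ℂ := fun j => ((γ / ((j : ℝ) + 2) : ℝ) : ℂ) with hu_def
  have hpos : ∀ j : ℕ, 0 < γ / ((j : ℝ) + 2) := fun j => by positivity
  have hle : ∀ j : ℕ, γ / ((j : ℝ) + 2) ≤ γ := fun j => by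
    rw [div_le_iff₀ (by positivity)]
    nlinarith [hγ, (Nat.cast_nonneg j : (0 : ℝ) ≤ j)]
  have hu : Tendsto u atTop (𝓝[≠] (0 : ℂ)) := by
    refine tendsto_nhdsWithin_iff.2 ⟨?_, Eventually.of_forall fun j => ?_⟩
    · have h1 : Tendsto (fun j : ℕ => γ / ((j : ℝ) + 2)) atTop (𝓝 0) :=
        tendsto_const_nhds.div_atTop (tendsto_natCast_atTop_atTop.atTop_add tendsto_const_nhds)
      have h2 : Tendsto u atTop (𝓝 ((0 : ℝ) : ℂ)) := (Complex.continuous_ofReal.tendsto 0).comp h1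
      rwa [Complex.ofReal_zero] at h2
    · have : u j ≠ 0 := by
        simp only [hu_def, ne_eq, Complex.ofReal_eq_zero]
        exact (hpos j).ne'
      exact this
  exact hu.frequently (Frequently.of_forall fun j => hp _ ⟨(hpos j).le, hle j⟩)

/-- **THE LIMIT (1.21) IN THE COUPLING PLANE (Vitali).**  Let `Fₙ` be holomorphic on a connected open `U ⊆ ℂ` containing `[0, γ]`
(`γ > 0`), eventually bounded by `K` on `U`, and convergent at every REAL coupling `t ∈ [0, γ]` to `ℓ(t)` (print, (1.21): *«This limit
exists by the localized representation (1.7).»*).  Then `Fₙ` converges at every point of `U` to a function `f` HOLOMORPHIC on `U`,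
bounded by `K`, with `f(t) = ℓ(t)` on `[0, γ]` — by Vitali's convergence theorem
(`Literature.Analysis.Complex.exists_tendstoLocallyUniformlyOn_of_frequently_tendsto`), the real couplings accumulating at `0 ∈ U`.
[cite: Balaban1987RG1, (1.21) p.264 with p.266 (analytic alternative)] -/
theorem exists_holo_limit (hU : IsOpen U) (hUc : IsPreconnected U) {γ : ℝ} (hγ : 0 < γ)
    (hIU : ∀ t ∈ Icc (0 : ℝ) γ, (t : ℂ) ∈ U) (F : ℕ → ℂ → ℂ) (hF : ∀ n, DifferentiableOn ℂ (F n) U)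
    {K : ℝ} (hK : ∀ᶠ n in atTop, ∀ g ∈ U, ‖F n g‖ ≤ K) (ℓ : ℝ → ℂ)
    (hlim : ∀ t ∈ Icc (0 : ℝ) γ, Tendsto (fun n => F n t) atTop (𝓝 (ℓ t))) :
    ∃ f : ℂ → ℂ, DifferentiableOn ℂ f U ∧ (∀ g ∈ U, Tendsto (fun n => F n g) atTop (𝓝 (f g))) ∧
      (∀ g ∈ U, ‖f g‖ ≤ K) ∧ (∀ t ∈ Icc (0 : ℝ) γ, f t = ℓ t) := by
  obtain ⟨N, hN⟩ := eventually_atTop.1 hK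
  set F' : ℕ → ℂ → ℂ := fun m => F (m + N) with hF'def
  have hF' : ∀ m, DifferentiableOn ℂ (F' m) U := fun m => hF _
  have hb : ∀ a ∈ U, ∃ M : ℝ, ∃ r > 0, ∀ m, ∀ w ∈ ball a r ∩ U, ‖F' m w‖ ≤ M :=
    fun a _ => ⟨K, 1, one_pos, fun m w hw => hN (m + N) (Nat.le_add_left N m) w hw.2⟩
  have hlim' : ∀ t ∈ Icc (0 : ℝ) γ, Tendsto (fun m => F' m t) atTop (𝓝 (ℓ t)) :=
    fun t ht => (hlim t ht).comp (tendsto_add_atTop_nat N)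
  have hS : ∃ᶠ w in 𝓝[≠] (0 : ℂ), ∃ c : ℂ, Tendsto (fun m => F' m w) atTop (𝓝 c) :=
    frequently_of_forall_Icc hγ (p := fun w => ∃ c : ℂ, Tendsto (fun m => F' m w) atTop (𝓝 c))
      fun t ht => ⟨ℓ t, hlim' t ht⟩
  have h0 : (0 : ℂ) ∈ U := by simpa using hIU 0 ⟨le_rfl, hγ.le⟩
  obtain ⟨f, hf, hconv⟩ :=
    Literature.Analysis.Complex.exists_tendstoLocallyUniformlyOn_of_frequently_tendsto hU hUc hF' hb h0 hS
  refine ⟨f, hf, fun g hg => ?_, fun g hg => ?_, fun t ht => ?_⟩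
  · exact (tendsto_add_atTop_iff_nat N).1 (hconv.tendsto_at hg)
  · exact le_of_tendsto' (hconv.tendsto_at hg).norm fun m => hN (m + N) (Nat.le_add_left N m) g hg
  · exact tendsto_nhds_unique (hconv.tendsto_at (hIU t ht)) (hlim' t ht)

end Limit

/-! ## §4. Assembly: a holomorphic Π-source from the analytic-in-the-coupling leaves of a sequence of finite volumes -/

section Assembly

variable {U : Set ℂ} {d : ℕ}

/-- **(1.20)–(1.21) IN HOLOMORPHIC CURRENCY, END TO END.**  A sequence `n` of finite systems (the tori `T^{(k+1)}`), on each: terms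
`(g, 𝐀) ↦ 𝐄ₙ(X, g, 𝐀)` jointly analytic on `U ×` (4.4) (`U ⊆ ℂ` connected open, `⊇ [0, γ]`, `γ > 0`) obeying (1.18) there uniformly
in `g ∈ U` (p. 266 + (1.5)∕(1.18)), responses `hₙ` with the p. 282 decay, the leaves `GeomLeaf`∕`CubeSumLeaf`∕`TreeLeaf` with
volume-uniform constants, window embeddings `eₙ : ℤ^d → Λₙ` eventually isometric on each pair (`hρ`), and convergence of the complex
kernels `Π_{Tₙ}(t; eₙ0, eₙz)` at every REAL `t ∈ [0, γ]` to the printed limit `Pℓ t z` ((1.21)).  THEN there is `Pc : ℂ → ℤ^d → ℂ`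
with every `g ↦ Pc(g, z)` HOLOMORPHIC on `U`, (5.10) ON `U` — `‖Pc(g, z)‖ ≤ 4E₀α₂⁻²B₃² e^{δ₁Mc₁}K₀K₁ · e^{−δ₁|z|₁}`, `δ₁ = ½ min{δ₀,
κM⁻¹}` — `Pc(t, z) = Pℓ t z` on `[0, γ]`, and `Π_{Tₙ}(g; eₙ0, eₙz) → Pc(g, z)` for every `g ∈ U`. [cite: Balaban1987RG1, (1.20)–(1.21) p.264 with p.266 and (5.10) p.293] -/
theorem exists_holo_kernel (hU : IsOpen U) (hUc : IsPreconnected U) {γ : ℝ} (hγ : 0 < γ)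
    (hIU : ∀ t ∈ Icc (0 : ℝ) γ, (t : ℂ) ∈ U)
    (Sn : ℕ → LocDomainSys) (Cn : (n : ℕ) → B12.CubeCover (Sn n)) (Λn : ℕ → Type*)
    (Gn : (n : ℕ) → B12Decay510.SiteGeometry (Cn n) (Λn n)) (ρn : (n : ℕ) → Λn n → Λn n → ℝ)
    (Wn : ℕ → Type*) [∀ n, NormedAddCommGroup (Wn n)] [∀ n, NormedSpace ℂ (Wn n)]
    (EXn : (n : ℕ) → ℂ → (Sn n).Dom → Wn n → ℂ) (hn : (n : ℕ) → (Sn n).Dom → Λn n → Wn n)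
    (e : (n : ℕ) → (Fin d → ℤ) → Λn n) (Pℓ : ℝ → (Fin d → ℤ) → ℂ)
    {α₂ E₀ B₃ κ δ₀ M c₁ K₀ K₁ : ℝ} (hα₂ : 0 < α₂) (hE₀ : 0 ≤ E₀) (hB₃ : 0 ≤ B₃) (hK₀ : 0 ≤ K₀) (hδ₀ : 0 ≤ δ₀)
    (hκ : 0 ≤ κ) (hM : 0 < M)
    (han : ∀ n X, AnalyticOnNhd ℂ (fun p : ℂ × Wn n => EXn n p.1 X p.2) (U ×ˢ ball 0 α₂))
    (h118 : ∀ n, ∀ g ∈ U, ∀ X, ∀ v ∈ ball (0 : Wn n) α₂, ‖EXn n g X v‖ ≤ E₀ * Real.exp (-κ * (Sn n).dj X))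
    (hh : ∀ n X x, ‖hn n X x‖ ≤ B₃ * Real.exp (-δ₀ * (Gn n).distD x X))
    (hgeo : ∀ n, B12Decay510.GeomLeaf (Gn n) (ρn n) M c₁) (hcube : ∀ n, B12Decay510.CubeSumLeaf (Gn n) (δ₀ / 2) K₁)
    (htree : ∀ n, B12Decay510.TreeLeaf (Cn n) (κ / 2) K₀)
    (hρ : ∀ z, ∀ᶠ n in atTop, ρn n (e n 0) (e n z) = B12Sec2to5.l1 z)
    (hlim : ∀ z, ∀ t ∈ Icc (0 : ℝ) γ, Tendsto (fun n => piT (EXn n) (hn n) t (e n 0) (e n z)) atTop (𝓝 (Pℓ t z))) :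
    ∃ Pc : ℂ → (Fin d → ℤ) → ℂ, (∀ z, DifferentiableOn ℂ (fun g => Pc g z) U) ∧
      (∀ z, ∀ g ∈ U, ‖Pc g z‖ ≤ 4 * E₀ / α₂ ^ 2 * B₃ ^ 2 * Real.exp (B12Decay510.delta1 δ₀ κ M * M * c₁) * K₀ * K₁ *
        Real.exp (-(B12Decay510.delta1 δ₀ κ M) * B12Sec2to5.l1 z)) ∧
      (∀ z, ∀ t ∈ Icc (0 : ℝ) γ, Pc t z = Pℓ t z) ∧
      (∀ z, ∀ g ∈ U, Tendsto (fun n => piT (EXn n) (hn n) g (e n 0) (e n z)) atTop (𝓝 (Pc g z))) := by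
  set Kc : ℝ := 4 * E₀ / α₂ ^ 2 * B₃ ^ 2 * Real.exp (B12Decay510.delta1 δ₀ κ M * M * c₁) * K₀ * K₁ with hKc
  -- per lattice point: Vitali
  have key : ∀ z : Fin d → ℤ, ∃ f : ℂ → ℂ, DifferentiableOn ℂ f U ∧
      (∀ g ∈ U, Tendsto (fun n => piT (EXn n) (hn n) g (e n 0) (e n z)) atTop (𝓝 (f g))) ∧
      (∀ g ∈ U, ‖f g‖ ≤ Kc * Real.exp (-(B12Decay510.delta1 δ₀ κ M) * B12Sec2to5.l1 z)) ∧
      (∀ t ∈ Icc (0 : ℝ) γ, f t = Pℓ t z) := by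
    intro z
    refine exists_holo_limit hU hUc hγ hIU (fun n g => piT (EXn n) (hn n) g (e n 0) (e n z))
      (fun n => differentiableOn_piT hU hα₂ (EXn n) (hn n) (han n) _ _) ?_ (fun t => Pℓ t z) (hlim z)
    filter_upwards [hρ z] with n hn' g hg
    have hb := norm_piT_le (Gn n) (ρ := ρn n) (EXn n) (hn n) hα₂ hE₀ hB₃ hK₀ hδ₀ hκ hM (g := g)
      (fun X => analyticOnNhd_section (fun g' => EXn n g' X) (han n X) hg) (h118 n g hg) (hh n) (hgeo n)
      (hcube n) (htree n) (e n 0) (e n z)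
    rw [hn'] at hb
    exact hb
  choose f hf hconv hbd hreal using key
  exact ⟨fun g z => f z g, fun z => hf z, fun z => hbd z, fun z => hreal z, fun z => hconv z⟩

variable {P : Params} {G : Type*} [GaugeGroup G] {Φ 𝒢 : Type*}

/-- **`B12BetaSmooth.PolarizationDerivTransfer` IN HOLOMORPHIC CURRENCY, PROVED**: under the leaves of `exists_holo_kernel` with the
coupling neighbourhood `U ⊇ [0, c.γ]`, `δ₀, κ > 0`, a tower whose `β_{k+1}` is (5.42) of a real kernel family `Pk` whose
`(μ, ν)`-component is the REAL PART of the printed limit `Pℓ` at real couplings, and `β′ ≥ betaPrime510 d C δ₁` for the explicit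
`C = 4E₀α₂⁻²B₃² e^{δ₁Mc₁}K₀K₁`, `δ₁ = ½ min{δ₀, κM⁻¹}`: `Nonempty (B12BetaHolo.PiHoloSource T c k)` — hence (by
`B12BetaHolo.betaClauses_of_piHolo`) `BetaSmoothAt`, `BetaAnalyticAt`, `|β_{k+1}| ≤ β′` and all-derivative bounds at the step.  No
g-derivative of any `E^{(j)}` is assumed. [cite: Balaban1987RG1, (1.20)–(1.22) p.264, p.266 (analytic alternative), (5.10) p.293, (5.42) p.297] -/
theorem nonempty_piHoloSource_of_analytic_leaves {T : SFTower P G Φ 𝒢} {c : SFConsts} {k : ℕ}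
    (hU : IsOpen U) (hUc : IsPreconnected U) (hγ : 0 < c.γ) (hIU : ∀ t ∈ Icc (0 : ℝ) c.γ, (t : ℂ) ∈ U)
    (Sn : ℕ → LocDomainSys) (Cn : (n : ℕ) → B12.CubeCover (Sn n)) (Λn : ℕ → Type*)
    (Gn : (n : ℕ) → B12Decay510.SiteGeometry (Cn n) (Λn n)) (ρn : (n : ℕ) → Λn n → Λn n → ℝ)
    (Wn : ℕ → Type*) [∀ n, NormedAddCommGroup (Wn n)] [∀ n, NormedSpace ℂ (Wn n)]
    (EXn : (n : ℕ) → ℂ → (Sn n).Dom → Wn n → ℂ) (hn : (n : ℕ) → (Sn n).Dom → Λn n → Wn n)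
    (e : (n : ℕ) → (Fin d → ℤ) → Λn n) (Pℓ : ℝ → (Fin d → ℤ) → ℂ) (μ ν : Fin d) (Pk : ℝ → B12Beta.Kernel d)
    (beta_eq : ∀ g, 0 ≤ g → g ≤ c.γ → T.flow.β (k + 1) g = B12Beta.secondMoment (Pk g) μ ν)
    (hPk : ∀ z, ∀ t ∈ Icc (0 : ℝ) c.γ, Pk t μ ν z = (Pℓ t z).re)
    {α₂ E₀ B₃ κ δ₀ M c₁ K₀ K₁ : ℝ} (hα₂ : 0 < α₂) (hE₀ : 0 ≤ E₀) (hB₃ : 0 ≤ B₃) (hK₀ : 0 ≤ K₀) (hδ₀ : 0 < δ₀)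
    (hκ : 0 < κ) (hM : 0 < M)
    (le_beta' : B12Sec2to5.betaPrime510 d
      (4 * E₀ / α₂ ^ 2 * B₃ ^ 2 * Real.exp (B12Decay510.delta1 δ₀ κ M * M * c₁) * K₀ * K₁)
      (B12Decay510.delta1 δ₀ κ M) ≤ c.β')
    (han : ∀ n X, AnalyticOnNhd ℂ (fun p : ℂ × Wn n => EXn n p.1 X p.2) (U ×ˢ ball 0 α₂))
    (h118 : ∀ n, ∀ g ∈ U, ∀ X, ∀ v ∈ ball (0 : Wn n) α₂, ‖EXn n g X v‖ ≤ E₀ * Real.exp (-κ * (Sn n).dj X))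
    (hh : ∀ n X x, ‖hn n X x‖ ≤ B₃ * Real.exp (-δ₀ * (Gn n).distD x X))
    (hgeo : ∀ n, B12Decay510.GeomLeaf (Gn n) (ρn n) M c₁) (hcube : ∀ n, B12Decay510.CubeSumLeaf (Gn n) (δ₀ / 2) K₁)
    (htree : ∀ n, B12Decay510.TreeLeaf (Cn n) (κ / 2) K₀)
    (hρ : ∀ z, ∀ᶠ n in atTop, ρn n (e n 0) (e n z) = B12Sec2to5.l1 z)
    (hlim : ∀ z, ∀ t ∈ Icc (0 : ℝ) c.γ,
      Tendsto (fun n => piT (EXn n) (hn n) t (e n 0) (e n z)) atTop (𝓝 (Pℓ t z))) :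
    Nonempty (PiHoloSource T c k) := by
  obtain ⟨Pc, hPc, hbd, hreal, -⟩ := exists_holo_kernel hU hUc hγ hIU Sn Cn Λn Gn ρn Wn EXn hn e Pℓ hα₂ hE₀
    hB₃ hK₀ hδ₀.le hκ.le hM han h118 hh hgeo hcube htree hρ hlim
  exact nonempty_piHoloSource μ ν Pk beta_eq hU hIU Pc hPc (B12Decay510.delta1_pos hδ₀ hκ hM) hbd
    (fun z t ht => by rw [hPk z t ht, hreal z t ht]) le_beta'

/-- **The β-clauses of the Theorem-3 step FROM THE ANALYTIC-IN-THE-COUPLING LEAVES** (composition of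
`nonempty_piHoloSource_of_analytic_leaves` with `B12BetaHolo.betaClauses_of_piHolo`): `BetaSmoothAt` (the unsourced p. 264 clause),
`BetaAnalyticAt` («(or analytic)»), `|β_{k+1}| ≤ β′`, and all-derivative bounds for some constants. [cite: Balaban1987RG1, p.264 (β-clause) with p.266 (analytic alternative)] -/
theorem betaClauses_of_analytic_leaves {T : SFTower P G Φ 𝒢} {c : SFConsts} {k : ℕ}
    (hU : IsOpen U) (hUc : IsPreconnected U) (hγ : 0 < c.γ) (hIU : ∀ t ∈ Icc (0 : ℝ) c.γ, (t : ℂ) ∈ U)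
    (Sn : ℕ → LocDomainSys) (Cn : (n : ℕ) → B12.CubeCover (Sn n)) (Λn : ℕ → Type*)
    (Gn : (n : ℕ) → B12Decay510.SiteGeometry (Cn n) (Λn n)) (ρn : (n : ℕ) → Λn n → Λn n → ℝ)
    (Wn : ℕ → Type*) [∀ n, NormedAddCommGroup (Wn n)] [∀ n, NormedSpace ℂ (Wn n)]
    (EXn : (n : ℕ) → ℂ → (Sn n).Dom → Wn n → ℂ) (hn : (n : ℕ) → (Sn n).Dom → Λn n → Wn n)
    (e : (n : ℕ) → (Fin d → ℤ) → Λn n) (Pℓ : ℝ → (Fin d → ℤ) → ℂ) (μ ν : Fin d) (Pk : ℝ → B12Beta.Kernel d)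
    (beta_eq : ∀ g, 0 ≤ g → g ≤ c.γ → T.flow.β (k + 1) g = B12Beta.secondMoment (Pk g) μ ν)
    (hPk : ∀ z, ∀ t ∈ Icc (0 : ℝ) c.γ, Pk t μ ν z = (Pℓ t z).re)
    {α₂ E₀ B₃ κ δ₀ M c₁ K₀ K₁ : ℝ} (hα₂ : 0 < α₂) (hE₀ : 0 ≤ E₀) (hB₃ : 0 ≤ B₃) (hK₀ : 0 ≤ K₀) (hδ₀ : 0 < δ₀)
    (hκ : 0 < κ) (hM : 0 < M)
    (le_beta' : B12Sec2to5.betaPrime510 d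
      (4 * E₀ / α₂ ^ 2 * B₃ ^ 2 * Real.exp (B12Decay510.delta1 δ₀ κ M * M * c₁) * K₀ * K₁)
      (B12Decay510.delta1 δ₀ κ M) ≤ c.β')
    (han : ∀ n X, AnalyticOnNhd ℂ (fun p : ℂ × Wn n => EXn n p.1 X p.2) (U ×ˢ ball 0 α₂))
    (h118 : ∀ n, ∀ g ∈ U, ∀ X, ∀ v ∈ ball (0 : Wn n) α₂, ‖EXn n g X v‖ ≤ E₀ * Real.exp (-κ * (Sn n).dj X))
    (hh : ∀ n X x, ‖hn n X x‖ ≤ B₃ * Real.exp (-δ₀ * (Gn n).distD x X))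
    (hgeo : ∀ n, B12Decay510.GeomLeaf (Gn n) (ρn n) M c₁) (hcube : ∀ n, B12Decay510.CubeSumLeaf (Gn n) (δ₀ / 2) K₁)
    (htree : ∀ n, B12Decay510.TreeLeaf (Cn n) (κ / 2) K₀)
    (hρ : ∀ z, ∀ᶠ n in atTop, ρn n (e n 0) (e n z) = B12Sec2to5.l1 z)
    (hlim : ∀ z, ∀ t ∈ Icc (0 : ℝ) c.γ,
      Tendsto (fun n => piT (EXn n) (hn n) t (e n 0) (e n z)) atTop (𝓝 (Pℓ t z))) :
    BetaSmoothAt T c k ∧ BetaAnalyticAt T c k ∧ (∀ x ∈ Set.Icc (0 : ℝ) c.γ, |T.flow.β (k + 1) x| ≤ c.β') ∧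
      ∃ β'n : ℕ → ℝ, BetaDerivBoundsAt T c k β'n := by
  obtain ⟨S⟩ := nonempty_piHoloSource_of_analytic_leaves hU hUc hγ hIU Sn Cn Λn Gn ρn Wn EXn hn e Pℓ μ ν Pk
    beta_eq hPk hα₂ hE₀ hB₃ hK₀ hδ₀ hκ hM le_beta' han h118 hh hgeo hcube htree hρ hlim
  obtain ⟨h1, h2, h3, h4⟩ := betaClauses_of_piHolo hγ S
  exact ⟨h1, h2, h3, _, h4⟩

end Assembly

end Literature.MathematicalPhysics.QuantumFieldTheory.Balaban1983to89.B12PolarizationHolo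

end
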